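import Summits.ValiantsHypothesis.ValiantsHypothesis.Theorems.LacunarySymmetroidMatrixDescartesCensusDoorA34DefiniteLetter
import Summits.ValiantsHypothesis.ValiantsHypothesis.Theorems.LacunarySymmetroidMatrixDescartesCensusDoorA34IsotropicTangentCentre

/-!
# `MatrixDescartes` census — DOOR A at `(3,4)`: the DEFINITE-LETTER INERTIA LAW with the MIXED-DISCRIMINANT sign (definite triples)

HONEST FRAMING.  Object-search cell `pub-symmetroid`, door-A seat `val-sym-door-p3` (g14); helper file beside the OPEN typed statement
`DoorA34 = PosRootLawAt 3 4 18` (route item `Theses.LacunarySymmetroid.DoorA34`, stmt-ValiantsHypothesis-19980), asserted nowhere here.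
Sequel to …CensusDoorA34DefiniteLetter (pair law, propagation law, σ-test).  Its propagation law often makes SEVERAL letters of a would-be nineteen
definite; this file adds the one remaining sign-level fact about definite letters — the sign of the MIXED monomial `X^(d_x+d_y+d_z)`:
* `mixedTerm_eq_polarisation`, `mixedTerm_congr`, `mixedTerm_one_diagonal` — the coefficient `tr((adj(S_x+S_y) − adj S_x − adj S_y)·S_z)`
  (`Census.coeff_det_pencil_three_mixed`, `= 6·D(S_x,S_y,S_z)`) is the full polarisation of `det`, is multiplied by `det P²` under a congruence, and
  equals `Σ_i β_i (C_jj + C_kk)` at `(1, diag β, C)`;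
* `exists_common_congruence` — a positive definite `A` and a symmetric `B` are SIMULTANEOUSLY congruent to `(1, diag β)` (spectral theorem twice, any
  size); hence **`mixedTerm_pos_of_posDef`: the mixed discriminant of three positive definite `3 × 3` matrices is positive** [folklore], and for three
  DEFINITE letters the mixed coefficient has the sign `σ_xσ_yσ_z` (`definite_triple_parity`: the rank parity `ρ(d_x+d_y+d_z)+ρ(3d_x)` is `[σ_y ≠ σ_z]`);
* **`card_posRoots_le_18_of_definite_letter'`** — THE STRENGTHENED LAW (all supports, decidable): as in …DefiniteLetter, the sign assignments `σ`
  must moreover satisfy `ρ(d_x+d_y+d_z)+ρ(3d_x) ≡ [σ_y ≠ σ_z]` on every definite triple; if none exists, `Z₊ ≤ 18`;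
* instances (`decide`): on `(0,1,8,11)`, `(0,1,9,12)` (two more of the twelve `IIII`-residue supports of …Box12IIII) and `(0,1,10,14)` EVERY
  definite letter is obstructed (there the edge counts are all `0` or `3`, so one definite letter makes all four definite, and the twenty signs
  `σ_iσ_jσ_k` are not an alternation).
Located (this seat, `d₃ ≤ 30`): the strengthened test obstructs 4368 of the 8240 pairs (support, definite letter) (3400 without the triple sign) and
all four letters on 864 of 2060 supports (622 before).  Nothing here bounds `ζ_sym(3,4)`; `DoorA34` stays OPEN; nothing on `MatrixDescartes`
(stmt-18050) / `VP ≠ VNP`.  [folklore] positivity of mixed discriminants; the spectral theorem; Descartes' rule; elementary.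
-/

open Polynomial Finset Matrix

-- `Summit.ValiantsHypothesis.ValiantsHypothesis.…` repeats a component by the D-0017 layout
-- (single-conjunct summit), which the `dupNamespace` linter flags; the name is mandated.
set_option linter.dupNamespace false

namespace Summit.ValiantsHypothesis.ValiantsHypothesis.Theorems.LacunarySymmetroidMatrixDescartes.Census

/-! ## 1. The mixed term -/

/-- The mixed term is the full polarisation of the `3 × 3` determinant. [folklore] -/
theorem mixedTerm_eq_polarisation (A B T : Matrix (Fin 3) (Fin 3) ℝ) :
    (((A + B).adjugate - A.adjugate - B.adjugate) * T).trace
      = (A + B + T).det - (A + B).det - (A + T).det - (B + T).det + A.det + B.det + T.det := by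
  simp only [Matrix.det_fin_three, Matrix.trace_fin_three, Matrix.mul_apply, Fin.sum_univ_three, Matrix.adjugate_fin_three,
    Matrix.of_apply, Matrix.add_apply, Matrix.sub_apply, Matrix.cons_val', Matrix.cons_val_zero, Matrix.cons_val_one,
    Matrix.cons_val_two, Matrix.empty_val', Matrix.cons_val_fin_one, Matrix.head_cons, Matrix.tail_cons, Matrix.head_fin_const]
  ring

/-- A congruence multiplies every determinant by `det P²`. [folklore] -/
theorem det_transpose_mul_mul' (P M : Matrix (Fin 3) (Fin 3) ℝ) : (Pᵀ * M * P).det = P.det ^ 2 * M.det := by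
  rw [det_mul, det_mul, det_transpose]; ring

/-- **Covariance of the mixed term under a congruence**: it is multiplied by `det P²`. [folklore] -/
theorem mixedTerm_congr (P A B T : Matrix (Fin 3) (Fin 3) ℝ) :
    (((Pᵀ * A * P + Pᵀ * B * P).adjugate - (Pᵀ * A * P).adjugate - (Pᵀ * B * P).adjugate) * (Pᵀ * T * P)).trace
      = P.det ^ 2 * (((A + B).adjugate - A.adjugate - B.adjugate) * T).trace := by
  rw [mixedTerm_eq_polarisation, mixedTerm_eq_polarisation]
  have e2 : ∀ M N : Matrix (Fin 3) (Fin 3) ℝ, Pᵀ * M * P + Pᵀ * N * P = Pᵀ * (M + N) * P := fun M N => by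
    rw [Matrix.mul_add, Matrix.add_mul]
  rw [e2, e2, e2, e2]
  simp only [det_transpose_mul_mul']
  ring

/-- The mixed term at `(1, diag β, C)` is `Σ_i β_i (C_jj + C_kk)`. [folklore] -/
theorem mixedTerm_one_diagonal (β : Fin 3 → ℝ) (T : Matrix (Fin 3) (Fin 3) ℝ) :
    ((((1 : Matrix (Fin 3) (Fin 3) ℝ) + diagonal β).adjugate - (1 : Matrix (Fin 3) (Fin 3) ℝ).adjugate - (diagonal β).adjugate) * T).trace
      = β 0 * (T 1 1 + T 2 2) + β 1 * (T 0 0 + T 2 2) + β 2 * (T 0 0 + T 1 1) := by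
  rw [mixedTerm_eq_polarisation]
  have h1 : (1 : Matrix (Fin 3) (Fin 3) ℝ) = diagonal (fun _ => (1 : ℝ)) := by rw [← diagonal_one]
  rw [h1]
  simp only [Matrix.det_fin_three, Matrix.add_apply, diagonal_apply_eq, diagonal_apply_ne _ (by decide : (0 : Fin 3) ≠ 1),
    diagonal_apply_ne _ (by decide : (0 : Fin 3) ≠ 2), diagonal_apply_ne _ (by decide : (1 : Fin 3) ≠ 0),
    diagonal_apply_ne _ (by decide : (1 : Fin 3) ≠ 2), diagonal_apply_ne _ (by decide : (2 : Fin 3) ≠ 0),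
    diagonal_apply_ne _ (by decide : (2 : Fin 3) ≠ 1)]
  ring

/-- Sign flip in the first slot. [folklore] -/
theorem mixedTerm_neg_left (A B T : Matrix (Fin 3) (Fin 3) ℝ) :
    (((-A + B).adjugate - (-A).adjugate - B.adjugate) * T).trace = -((((A + B).adjugate - A.adjugate - B.adjugate) * T).trace) := by
  rw [mixedTerm_eq_polarisation, mixedTerm_eq_polarisation]
  simp only [Matrix.det_fin_three, Matrix.add_apply, Matrix.neg_apply]
  ring

/-- Sign flip in the second slot. [folklore] -/
theorem mixedTerm_neg_mid (A B T : Matrix (Fin 3) (Fin 3) ℝ) :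
    (((A + -B).adjugate - A.adjugate - (-B).adjugate) * T).trace = -((((A + B).adjugate - A.adjugate - B.adjugate) * T).trace) := by
  rw [mixedTerm_eq_polarisation, mixedTerm_eq_polarisation]
  simp only [Matrix.det_fin_three, Matrix.add_apply, Matrix.neg_apply]
  ring

/-- Sign flip in the third slot. [folklore] -/
theorem mixedTerm_neg_right (A B T : Matrix (Fin 3) (Fin 3) ℝ) :
    (((A + B).adjugate - A.adjugate - B.adjugate) * -T).trace = -((((A + B).adjugate - A.adjugate - B.adjugate) * T).trace) := by
  rw [Matrix.mul_neg, Matrix.trace_neg]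

/-! ## 2. Simultaneous congruence of a definite pair; the mixed discriminant of definite matrices -/

/-- **Simultaneous diagonalisation by congruence** (any size): a positive definite `A` and a symmetric `B` are `A = YᵀY`, `B = Yᵀ·diag β·Y`
for one invertible real `Y` (spectral theorem for `A`, then for `Y₀⁻ᵀ B Y₀⁻¹`). [folklore] -/
theorem exists_common_congruence {n : Type*} [Fintype n] [DecidableEq n] {A B : Matrix n n ℝ} (hA : A.PosDef) (hB : B.IsHermitian) :
    ∃ (Y : Matrix n n ℝ) (β : n → ℝ), Y.det ≠ 0 ∧ A = star Y * Y ∧ B = star Y * diagonal β * Y := by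
  -- `A = star Y₀ * Y₀`
  set U : Matrix n n ℝ := (hA.1.eigenvectorUnitary : Matrix n n ℝ) with hUdef
  set lam : n → ℝ := hA.1.eigenvalues with hlam
  have hlam_pos : ∀ i, 0 < lam i := fun i => hA.eigenvalues_pos i
  have hAeq : A = U * diagonal lam * star U := by simpa [Unitary.conjStarAlgAut_apply, hUdef, hlam] using hA.1.spectral_theorem
  have hUU : star U * U = 1 := Unitary.coe_star_mul_self _
  set E : Matrix n n ℝ := diagonal (fun i => Real.sqrt (lam i)) with hEdef
  have hEE : E * E = diagonal lam := by
    rw [hEdef, diagonal_mul_diagonal]; congr 1; funext i; exact Real.mul_self_sqrt (hlam_pos i).le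
  have hEstar : star E = E := by rw [star_eq_conjTranspose, hEdef, diagonal_conjTranspose]; congr 1
  set Y₀ : Matrix n n ℝ := E * star U with hY₀def
  have hY₀ : A = star Y₀ * Y₀ := by
    rw [hY₀def, star_mul, star_star, hEstar, hAeq, ← hEE]; simp only [Matrix.mul_assoc]
  have hEdet : E.det ≠ 0 := by
    rw [hEdef, det_diagonal]; exact Finset.prod_ne_zero_iff.mpr fun i _ => (Real.sqrt_pos.mpr (hlam_pos i)).ne'
  have hUdet : (star U).det ≠ 0 := fun h0 => by
    have := congrArg Matrix.det hUU
    rw [det_mul, h0, zero_mul, det_one] at this; exact zero_ne_one this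
  have hY₀det : Y₀.det ≠ 0 := by rw [hY₀def, det_mul]; exact mul_ne_zero hEdet hUdet
  have hY₀du : IsUnit Y₀.det := isUnit_iff_ne_zero.mpr hY₀det
  -- `B' = Y₀⁻ᴴ B Y₀⁻¹ = U₁ diag β U₁ᴴ`
  set B' : Matrix n n ℝ := star (Y₀⁻¹) * B * Y₀⁻¹ with hB'def
  have hB' : B'.IsHermitian := by
    rw [hB'def, star_eq_conjTranspose]; exact isHermitian_conjTranspose_mul_mul _ hB
  have hBB' : B = star Y₀ * B' * Y₀ := by
    rw [hB'def]
    calc B = star (Y₀⁻¹ * Y₀) * B * (Y₀⁻¹ * Y₀) := by rw [nonsing_inv_mul Y₀ hY₀du, star_one, one_mul, mul_one]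
      _ = star Y₀ * (star Y₀⁻¹ * B * Y₀⁻¹) * Y₀ := by rw [star_mul]; simp only [Matrix.mul_assoc]
  set U₁ : Matrix n n ℝ := (hB'.eigenvectorUnitary : Matrix n n ℝ) with hU₁def
  set β : n → ℝ := hB'.eigenvalues with hβ
  have hB'eq : B' = U₁ * diagonal β * star U₁ := by simpa [Unitary.conjStarAlgAut_apply, hU₁def, hβ] using hB'.spectral_theorem
  have hU₁ : star U₁ * U₁ = 1 := Unitary.coe_star_mul_self _
  have hU₁' : U₁ * star U₁ = 1 := Unitary.coe_mul_star_self _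
  have hU₁det : (star U₁).det ≠ 0 := fun h0 => by
    have := congrArg Matrix.det hU₁
    rw [det_mul, h0, zero_mul, det_one] at this; exact zero_ne_one this
  refine ⟨star U₁ * Y₀, β, ?_, ?_, ?_⟩
  · rw [det_mul]; exact mul_ne_zero hU₁det hY₀det
  · rw [star_mul, star_star, hY₀]
    calc star Y₀ * Y₀ = star Y₀ * (U₁ * star U₁) * Y₀ := by rw [hU₁', Matrix.mul_one]
      _ = star Y₀ * U₁ * (star U₁ * Y₀) := by simp only [Matrix.mul_assoc]
  · rw [star_mul, star_star, hBB', hB'eq]; simp only [Matrix.mul_assoc]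

/-- **The mixed discriminant of three positive definite `3 × 3` matrices is positive.** [folklore] -/
theorem mixedTerm_pos_of_posDef {A B T : Matrix (Fin 3) (Fin 3) ℝ} (hA : A.PosDef) (hB : B.PosDef) (hT : T.PosDef) :
    0 < (((A + B).adjugate - A.adjugate - B.adjugate) * T).trace := by
  obtain ⟨Y, β, hYdet, hAY, hBY⟩ := exists_common_congruence hA hB.1
  have hYdu : IsUnit Y.det := isUnit_iff_ne_zero.mpr hYdet
  have hYiu : IsUnit Y⁻¹ := (isUnit_iff_isUnit_det _).mpr (isUnit_nonsing_inv_det Y hYdu)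
  have hcancel : star (Y⁻¹) * star Y = 1 := by rw [← star_mul, mul_nonsing_inv Y hYdu, star_one]
  have hdiag : diagonal β = star (Y⁻¹) * B * Y⁻¹ := by
    rw [hBY]
    calc diagonal β = (star Y⁻¹ * star Y) * diagonal β * (Y * Y⁻¹) := by rw [hcancel, mul_nonsing_inv Y hYdu, one_mul, mul_one]
      _ = star Y⁻¹ * (star Y * diagonal β * Y) * Y⁻¹ := by simp only [Matrix.mul_assoc]
  have hβ : ∀ i, 0 < β i := by
    have hD : (diagonal β).PosDef := by rw [hdiag]; exact hYiu.posDef_star_left_conjugate_iff.mpr hB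
    exact posDef_diagonal_iff.mp hD
  set T' : Matrix (Fin 3) (Fin 3) ℝ := star (Y⁻¹) * T * Y⁻¹ with hT'def
  have hT' : T'.PosDef := hYiu.posDef_star_left_conjugate_iff.mpr hT
  have hTY : T = star Y * T' * Y := by
    rw [hT'def]
    calc T = star (Y⁻¹ * Y) * T * (Y⁻¹ * Y) := by rw [nonsing_inv_mul Y hYdu, star_one, one_mul, mul_one]
      _ = star Y * (star Y⁻¹ * T * Y⁻¹) * Y := by rw [star_mul]; simp only [Matrix.mul_assoc]
  have hst : star Y = Yᵀ := by rw [star_eq_conjTranspose, conjTranspose_eq_transpose_of_trivial]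
  rw [hAY, hBY, hTY, hst, show Yᵀ * Y = Yᵀ * 1 * Y by rw [Matrix.mul_one], mixedTerm_congr, mixedTerm_one_diagonal]
  have h0 := hT'.diag_pos (i := 0); have h1 := hT'.diag_pos (i := 1); have h2 := hT'.diag_pos (i := 2)
  have hY2 : 0 < Y.det ^ 2 := by positivity
  have := hβ 0; have := hβ 1; have := hβ 2
  positivity

/-! ## 3. The mixed monomial of a nineteen with three definite letters -/

/-- **Rank relation of the mixed monomial.**  For `19` distinct positive roots and pairwise distinct `x, y, z`, the coefficients at
`d_x+d_y+d_z` (the mixed term) and at `3d_x` (`det S_x`) satisfy Descartes' alternation relation. [folklore] -/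
theorem mixed_cube_rel_of_nineteen (d : Fin 4 → ℕ) (S : Fin 4 → Matrix (Fin 3) (Fin 3) ℝ) {x y z : Fin 4} (hxy : x ≠ y) (hxz : x ≠ z)
    (hyz : y ≠ z)
    (h19 : 19 ≤ ((Matrix.det (∑ l, ((X : ℝ[X]) ^ d l) • (S l).map C)).roots.toFinset.filter (fun t => 0 < t)).card)
    (ρ : ℕ → ℕ) (hρ : ∀ e, ρ e = (((Finset.univ : Finset (Fin 4 × Fin 4 × Fin 4)).image
      (fun p => d p.1 + d p.2.1 + d p.2.2)).filter (· < e)).card) :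
    0 < (-1 : ℝ) ^ (ρ (d x + d y + d z) + ρ (3 * d x))
      * ((((S x + S y).adjugate - (S x).adjugate - (S y).adjugate) * S z).trace * (S x).det) := by
  classical
  set P : ℝ[X] := (∑ l, (X : ℝ[X]) ^ d l • (S l).map C).det with hPdef
  have hP0 : P ≠ 0 := fun h0 => by
    rw [h0, Polynomial.roots_zero, Multiset.toFinset_zero, Finset.filter_empty, Finset.card_empty] at h19; omega
  set T : Finset ℕ := (Finset.univ : Finset (Fin 4 × Fin 4 × Fin 4)).image (fun p => d p.1 + d p.2.1 + d p.2.2) with hTdef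
  have hT20 : T.card ≤ 20 := card_tripleSums_le_of_collapse d id (fun _ => rfl) (by decide)
  have hsum3 : (Finset.univ : Finset (Fin 3 → Fin 4)).image (fun g => ∑ t, d (g t)) = T := sumset_three_eq_tripleSums d
  have hZ : ((Finset.univ : Finset (Fin 3 → Fin 4)).image (fun g => ∑ t, d (g t))).card
      ≤ (P.roots.toFinset.filter (fun t => 0 < t)).card + 1 := by rw [hsum3]; omega
  have hsupp : P.support = T := by rw [← hsum3]; exact support_det_pencil_eq_sumset_of_sharp d S hP0 hZ
  have hZ' : P.support.card ≤ (P.roots.toFinset.filter (fun t => 0 < t)).card + 1 := by rw [hsupp]; omega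
  have memT : ∀ a b c : Fin 4, d a + d b + d c ∈ P.support := fun a b c => by
    rw [hsupp, hTdef]; exact Finset.mem_image.mpr ⟨(a, b, c), Finset.mem_univ _, rfl⟩
  have hrank : ∀ e, (P.support.filter (· < e)).card = ρ e := fun e => by rw [hρ, hsupp]
  have hc0 : P.coeff (3 * d x) = (S x).det := by
    rw [hPdef, coeff_det_pencil_three_mul d S x (cube_unique_of_nineteen d S h19 x)]
  have hcm : P.coeff (d x + d y + d z) = (((S x + S y).adjugate - (S x).adjugate - (S y).adjugate) * S z).trace := by
    rw [hPdef, coeff_det_pencil_three_mixed d S hxy hxz hyz (mixed_unique_of_nineteen d S h19 hxy hxz hyz)]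
  have m0 : 3 * d x ∈ P.support := by rw [show 3 * d x = d x + d x + d x by ring]; exact memT x x x
  have r := pow_rank_mul_coeff_mul_coeff_pos_of_sharp P hZ' (memT x y z) m0
  rw [hrank, hrank, hc0, hcm] at r
  exact r

/-- **TRIPLE SIGN LAW.**  Three DEFINITE letters `S_x, S_y, S_z` of a nineteen: the mixed coefficient has the sign `σ_xσ_yσ_z`, so the rank parity
`ρ(d_x+d_y+d_z)+ρ(3d_x)` is `0` if `S_y, S_z` have the same sign and `1` otherwise. [folklore] -/
theorem definite_triple_parity (d : Fin 4 → ℕ) (S : Fin 4 → Matrix (Fin 3) (Fin 3) ℝ) {x y z : Fin 4} (hxy : x ≠ y) (hxz : x ≠ z)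
    (hyz : y ≠ z) (hx : (S x).PosDef ∨ (-S x).PosDef) (hy : (S y).PosDef ∨ (-S y).PosDef) (hz : (S z).PosDef ∨ (-S z).PosDef)
    (h19 : 19 ≤ ((Matrix.det (∑ l, ((X : ℝ[X]) ^ d l) • (S l).map C)).roots.toFinset.filter (fun t => 0 < t)).card)
    (ρ : ℕ → ℕ) (hρ : ∀ e, ρ e = (((Finset.univ : Finset (Fin 4 × Fin 4 × Fin 4)).image
      (fun p => d p.1 + d p.2.1 + d p.2.2)).filter (· < e)).card) :
    (((S y).PosDef ↔ (S z).PosDef) → (ρ (d x + d y + d z) + ρ (3 * d x)) % 2 = 0)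
    ∧ (¬ ((S y).PosDef ↔ (S z).PosDef) → (ρ (d x + d y + d z) + ρ (3 * d x)) % 2 = 1) := by
  have r := mixed_cube_rel_of_nineteen d S hxy hxz hyz h19 ρ hρ
  rcases hx with hx | hx <;> rcases hy with hy | hy <;> rcases hz with hz | hz
  · have m := mixedTerm_pos_of_posDef hx hy hz; have a0 := hx.det_pos
    exact ⟨fun _ => mod_two_eq_zero_of_rel r (mul_pos m a0), fun h => absurd (iff_of_true hy hz) h⟩
  · have m := mixedTerm_pos_of_posDef hx hy hz; rw [mixedTerm_neg_right] at m; have a0 := hx.det_pos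
    exact ⟨fun h => absurd (h.mp hy) (not_posDef_of_neg_posDef hz), fun _ => mod_two_eq_one_of_rel r (by nlinarith)⟩
  · have m := mixedTerm_pos_of_posDef hx hy hz; rw [mixedTerm_neg_mid] at m; have a0 := hx.det_pos
    exact ⟨fun h => absurd (h.mpr hz) (not_posDef_of_neg_posDef hy), fun _ => mod_two_eq_one_of_rel r (by nlinarith)⟩
  · have m := mixedTerm_pos_of_posDef hx hy hz; rw [mixedTerm_neg_mid, mixedTerm_neg_right, neg_neg] at m; have a0 := hx.det_pos
    exact ⟨fun _ => mod_two_eq_zero_of_rel r (mul_pos m a0),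
      fun h => absurd (iff_of_false (not_posDef_of_neg_posDef hy) (not_posDef_of_neg_posDef hz)) h⟩
  · have m := mixedTerm_pos_of_posDef hx hy hz; rw [mixedTerm_neg_left] at m; have a0 := det_neg_of_neg_posDef hx
    exact ⟨fun _ => mod_two_eq_zero_of_rel r (by nlinarith), fun h => absurd (iff_of_true hy hz) h⟩
  · have m := mixedTerm_pos_of_posDef hx hy hz; rw [mixedTerm_neg_left, mixedTerm_neg_right, neg_neg] at m
    have a0 := det_neg_of_neg_posDef hx
    exact ⟨fun h => absurd (h.mp hy) (not_posDef_of_neg_posDef hz), fun _ => mod_two_eq_one_of_rel r (by nlinarith)⟩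
  · have m := mixedTerm_pos_of_posDef hx hy hz; rw [mixedTerm_neg_left, mixedTerm_neg_mid, neg_neg] at m
    have a0 := det_neg_of_neg_posDef hx
    exact ⟨fun h => absurd (h.mpr hz) (not_posDef_of_neg_posDef hy), fun _ => mod_two_eq_one_of_rel r (by nlinarith)⟩
  · have m := mixedTerm_pos_of_posDef hx hy hz; rw [mixedTerm_neg_left, mixedTerm_neg_mid, mixedTerm_neg_right, neg_neg] at m
    have a0 := det_neg_of_neg_posDef hx
    exact ⟨fun _ => mod_two_eq_zero_of_rel r (by nlinarith),
      fun h => absurd (iff_of_false (not_posDef_of_neg_posDef hy) (not_posDef_of_neg_posDef hz)) h⟩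

/-! ## 4. The strengthened law -/

/-- **DEFINITE-LETTER INERTIA LAW with the triple sign (all supports).**  As `card_posRoots_le_18_of_definite_letter`, with the extra requirement on
the sign assignments `σ`: on every triple of pairwise distinct letters with `σ ≠ 0`, `(ρ(d_x+d_y+d_z)+ρ(3d_x)) % 2 = [σ_y ≠ σ_z]`
(one conjunctive hypothesis, to keep the test `decide`-able).  If no `σ` with
`σ a ≠ 0` passes, a pencil with definite `S_a` has at most `18` distinct positive determinant roots. [folklore] -/
theorem card_posRoots_le_18_of_definite_letter' (d : Fin 4 → ℕ) (S : Fin 4 → Matrix (Fin 3) (Fin 3) ℝ) (hS : ∀ l, (S l).IsSymm)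
    (a : Fin 4) (ha : (S a).PosDef ∨ (-S a).PosDef)
    (ρ : ℕ → ℕ) (hρ : ∀ e, ρ e = (((Finset.univ : Finset (Fin 4 × Fin 4 × Fin 4)).image
      (fun p => d p.1 + d p.2.1 + d p.2.2)).filter (· < e)).card)
    (V : Fin 4 → Fin 4 → ℕ)
    (hV : ∀ x y : Fin 4, x ≠ y → V x y = (ρ (3 * d x) + ρ (2 * d x + d y)) % 2
        + (ρ (2 * d x + d y) + ρ (2 * d y + d x)) % 2 + (ρ (2 * d y + d x) + ρ (3 * d y)) % 2)
    (W : Fin 4 → Fin 4 → Fin 4 → ℕ)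
    (hW : ∀ x y z : Fin 4, x ≠ y → x ≠ z → y ≠ z → W x y z = (ρ (d x + d y + d z) + ρ (3 * d x)) % 2)
    (htest : ∀ σ : Fin 4 → SignType, σ a ≠ 0 →
        (∀ x y : Fin 4, x ≠ y → σ x ≠ 0 → σ y ≠ 0 → V x y = if σ x = σ y then 0 else 3) →
        (∀ x y : Fin 4, x ≠ y → σ x ≠ 0 → σ y = 0 → V x y ≠ 0 ∧ V x y ≠ 3) →
        (∀ x y z : Fin 4, x ≠ y ∧ x ≠ z ∧ y ≠ z ∧ σ x ≠ 0 ∧ σ y ≠ 0 ∧ σ z ≠ 0 → W x y z = if σ y = σ z then 0 else 1) → False) :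
    ((Matrix.det (∑ l, ((X : ℝ[X]) ^ d l) • (S l).map C)).roots.toFinset.filter (fun t => 0 < t)).card ≤ 18 := by
  classical
  by_contra hlt; push Not at hlt
  have h19 : 19 ≤ ((Matrix.det (∑ l, ((X : ℝ[X]) ^ d l) • (S l).map C)).roots.toFinset.filter (fun t => 0 < t)).card := by omega
  let σ : Fin 4 → SignType := fun x => if (S x).PosDef then 1 else if (-S x).PosDef then -1 else 0
  have hσdef : ∀ x, σ x ≠ 0 → (S x).PosDef ∨ (-S x).PosDef := fun x hx => by
    by_contra h; push Not at h; exact hx (by simp [σ, h.1, h.2])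
  have hσpos : ∀ x, (S x).PosDef → σ x = 1 := fun x hx => by simp [σ, hx]
  have hσneg : ∀ x, (-S x).PosDef → σ x = -1 := fun x hx => by
    have hnx : ¬ (S x).PosDef := not_posDef_of_neg_posDef hx; simp [σ, hx, hnx]
  refine htest σ ?_ ?_ ?_ ?_
  · rcases ha with ha | ha
    · rw [hσpos a ha]; decide
    · rw [hσneg a ha]; decide
  · intro x y hxy hx hy
    have hx' := hσdef x hx; have hy' := hσdef y hy
    obtain ⟨hsame, hdiff⟩ := definite_pair_count d S hxy hx' hy' h19 ρ hρ
    rw [hV x y hxy]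
    rcases hx' with hx' | hx' <;> rcases hy' with hy' | hy'
    · rw [hsame (iff_of_true hx' hy'), hσpos x hx', hσpos y hy']; decide
    · rw [hdiff (fun h => not_posDef_of_neg_posDef hy' (h.mp hx')), hσpos x hx', hσneg y hy']; decide
    · rw [hdiff (fun h => not_posDef_of_neg_posDef hx' (h.mpr hy')), hσneg x hx', hσpos y hy']; decide
    · rw [hsame (iff_of_false (not_posDef_of_neg_posDef hx') (not_posDef_of_neg_posDef hy')), hσneg x hx', hσneg y hy']
      decide
  · intro x y hxy hx hy
    have hx' := hσdef x hx
    have hny : ¬ (S y).PosDef := fun h => by rw [hσpos y h] at hy; exact absurd hy (by decide)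
    have hny' : ¬ (-S y).PosDef := fun h => by rw [hσneg y h] at hy; exact absurd hy (by decide)
    rw [hV x y hxy]
    exact definite_indefinite_count d S hS hxy hx' hny hny' h19 ρ hρ
  · rintro x y z ⟨hxy, hxz, hyz, hx, hy, hz⟩
    have hx' := hσdef x hx; have hy' := hσdef y hy; have hz' := hσdef z hz
    obtain ⟨hs, hd⟩ := definite_triple_parity d S hxy hxz hyz hx' hy' hz' h19 ρ hρ
    rw [hW x y z hxy hxz hyz]
    rcases hy' with hy' | hy' <;> rcases hz' with hz' | hz'
    · rw [hs (iff_of_true hy' hz'), hσpos y hy', hσpos z hz']; decide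
    · rw [hd (fun h => not_posDef_of_neg_posDef hz' (h.mp hy')), hσpos y hy', hσneg z hz']; decide
    · rw [hd (fun h => not_posDef_of_neg_posDef hy' (h.mpr hz')), hσneg y hy', hσpos z hz']; decide
    · rw [hs (iff_of_false (not_posDef_of_neg_posDef hy') (not_posDef_of_neg_posDef hz')), hσneg y hy', hσneg z hz']; decide

/-! ## 5. Instances: the bipartite edge table -/

set_option synthInstance.maxSize 1024 in
set_option synthInstance.maxHeartbeats 200000 in
/-- **The bipartite tables fail the strengthened test for every definite letter.**  With all edge counts `V ∈ {0,3}` in the pattern of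
`(0,1,8,11)` one definite letter makes every letter definite with signs `(s,−s,s,−s)`, and then the mixed-monomial parities `W` are violated. [folklore] -/
theorem bipartiteTables_test : ∀ (a : Fin 4) (σ : Fin 4 → SignType), σ a ≠ 0 →
    (∀ x y : Fin 4, x ≠ y → σ x ≠ 0 → σ y ≠ 0 → (![![0, 3, 0, 3], ![3, 0, 3, 0], ![0, 3, 0, 3], ![3, 0, 3, 0]] : Fin 4 → Fin 4 → ℕ) x y = if σ x = σ y then 0 else 3) →
    (∀ x y : Fin 4, x ≠ y → σ x ≠ 0 → σ y = 0 →
      (![![0, 3, 0, 3], ![3, 0, 3, 0], ![0, 3, 0, 3], ![3, 0, 3, 0]] : Fin 4 → Fin 4 → ℕ) x y ≠ 0 ∧ (![![0, 3, 0, 3], ![3, 0, 3, 0], ![0, 3, 0, 3], ![3, 0, 3, 0]] : Fin 4 → Fin 4 → ℕ) x y ≠ 3) →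
    (∀ x y z : Fin 4, x ≠ y ∧ x ≠ z ∧ y ≠ z ∧ σ x ≠ 0 ∧ σ y ≠ 0 ∧ σ z ≠ 0 →
      (![![![0, 0, 0, 0], ![0, 0, 1, 0], ![0, 1, 0, 0], ![0, 0, 0, 0]], ![![0, 0, 0, 1], ![0, 0, 0, 0], ![0, 0, 0, 0], ![1, 0, 0, 0]], ![![0, 1, 0, 0], ![1, 0, 0, 1], ![0, 0, 0, 0], ![0, 1, 0, 0]], ![![0, 1, 1, 0], ![1, 0, 0, 0], ![1, 0, 0, 0], ![0, 0, 0, 0]]] : Fin 4 → Fin 4 → Fin 4 → ℕ) x y z = if σ y = σ z then 0 else 1) → False := by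
  decide

/-- **`(0,1,8,11)`: a nineteen has four indefinite letters** — every pencil on this support with a definite letter has at most `18` distinct positive determinant roots. [folklore] -/
theorem card_posRoots_le_18_of_definite_letter'_on_0_1_8_11 (S : Fin 4 → Matrix (Fin 3) (Fin 3) ℝ) (hS : ∀ l, (S l).IsSymm)
    (a : Fin 4) (ha : (S a).PosDef ∨ (-S a).PosDef) :
    ((Matrix.det (∑ l, ((X : ℝ[X]) ^ ((![0, 1, 8, 11] : Fin 4 → ℕ)) l) • (S l).map C)).roots.toFinset.filter (fun t => 0 < t)).card
      ≤ 18 := by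
  have hT : ((Finset.univ : Finset (Fin 4 × Fin 4 × Fin 4)).image
      (fun p => (![0, 1, 8, 11] : Fin 4 → ℕ) p.1 + (![0, 1, 8, 11] : Fin 4 → ℕ) p.2.1 + (![0, 1, 8, 11] : Fin 4 → ℕ) p.2.2))
        = ({0, 1, 2, 3, 8, 9, 10, 11, 12, 13, 16, 17, 19, 20, 22, 23, 24, 27, 30, 33} : Finset ℕ) := by decide
  refine card_posRoots_le_18_of_definite_letter' _ S hS a ha
    (fun e => ((({0, 1, 2, 3, 8, 9, 10, 11, 12, 13, 16, 17, 19, 20, 22, 23, 24, 27, 30, 33} : Finset ℕ)).filter (· < e)).card)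
    (fun e => by rw [hT]) (![![0, 3, 0, 3], ![3, 0, 3, 0], ![0, 3, 0, 3], ![3, 0, 3, 0]]) (by decide)
    (![![![0, 0, 0, 0], ![0, 0, 1, 0], ![0, 1, 0, 0], ![0, 0, 0, 0]], ![![0, 0, 0, 1], ![0, 0, 0, 0], ![0, 0, 0, 0], ![1, 0, 0, 0]], ![![0, 1, 0, 0], ![1, 0, 0, 1], ![0, 0, 0, 0], ![0, 1, 0, 0]], ![![0, 1, 1, 0], ![1, 0, 0, 0], ![1, 0, 0, 0], ![0, 0, 0, 0]]]) (by decide) ?_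
  clear ha; revert a; exact bipartiteTables_test

/-- **`(0,1,9,12)`: a nineteen has four indefinite letters.** [folklore] -/
theorem card_posRoots_le_18_of_definite_letter'_on_0_1_9_12 (S : Fin 4 → Matrix (Fin 3) (Fin 3) ℝ) (hS : ∀ l, (S l).IsSymm)
    (a : Fin 4) (ha : (S a).PosDef ∨ (-S a).PosDef) :
    ((Matrix.det (∑ l, ((X : ℝ[X]) ^ ((![0, 1, 9, 12] : Fin 4 → ℕ)) l) • (S l).map C)).roots.toFinset.filter (fun t => 0 < t)).card
      ≤ 18 := by
  have hT : ((Finset.univ : Finset (Fin 4 × Fin 4 × Fin 4)).image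
      (fun p => (![0, 1, 9, 12] : Fin 4 → ℕ) p.1 + (![0, 1, 9, 12] : Fin 4 → ℕ) p.2.1 + (![0, 1, 9, 12] : Fin 4 → ℕ) p.2.2))
        = ({0, 1, 2, 3, 9, 10, 11, 12, 13, 14, 18, 19, 21, 22, 24, 25, 27, 30, 33, 36} : Finset ℕ) := by decide
  refine card_posRoots_le_18_of_definite_letter' _ S hS a ha
    (fun e => ((({0, 1, 2, 3, 9, 10, 11, 12, 13, 14, 18, 19, 21, 22, 24, 25, 27, 30, 33, 36} : Finset ℕ)).filter (· < e)).card)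
    (fun e => by rw [hT]) (![![0, 3, 0, 3], ![3, 0, 3, 0], ![0, 3, 0, 3], ![3, 0, 3, 0]]) (by decide)
    (![![![0, 0, 0, 0], ![0, 0, 1, 0], ![0, 1, 0, 0], ![0, 0, 0, 0]], ![![0, 0, 0, 1], ![0, 0, 0, 0], ![0, 0, 0, 0], ![1, 0, 0, 0]], ![![0, 1, 0, 0], ![1, 0, 0, 1], ![0, 0, 0, 0], ![0, 1, 0, 0]], ![![0, 1, 1, 0], ![1, 0, 0, 0], ![1, 0, 0, 0], ![0, 0, 0, 0]]]) (by decide) ?_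
  clear ha; revert a; exact bipartiteTables_test

/-- **`(0,1,10,14)`** (the support of the two class-R0 census sixteens): a nineteen has four indefinite letters. [folklore] -/
theorem card_posRoots_le_18_of_definite_letter'_on_0_1_10_14 (S : Fin 4 → Matrix (Fin 3) (Fin 3) ℝ) (hS : ∀ l, (S l).IsSymm)
    (a : Fin 4) (ha : (S a).PosDef ∨ (-S a).PosDef) :
    ((Matrix.det (∑ l, ((X : ℝ[X]) ^ ((![0, 1, 10, 14] : Fin 4 → ℕ)) l) • (S l).map C)).roots.toFinset.filter (fun t => 0 < t)).card
      ≤ 18 := by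
  have hT : ((Finset.univ : Finset (Fin 4 × Fin 4 × Fin 4)).image
      (fun p => (![0, 1, 10, 14] : Fin 4 → ℕ) p.1 + (![0, 1, 10, 14] : Fin 4 → ℕ) p.2.1 + (![0, 1, 10, 14] : Fin 4 → ℕ) p.2.2))
        = ({0, 1, 2, 3, 10, 11, 12, 14, 15, 16, 20, 21, 24, 25, 28, 29, 30, 34, 38, 42} : Finset ℕ) := by decide
  refine card_posRoots_le_18_of_definite_letter' _ S hS a ha
    (fun e => ((({0, 1, 2, 3, 10, 11, 12, 14, 15, 16, 20, 21, 24, 25, 28, 29, 30, 34, 38, 42} : Finset ℕ)).filter (· < e)).card)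
    (fun e => by rw [hT]) (![![0, 3, 0, 3], ![3, 0, 3, 0], ![0, 3, 0, 3], ![3, 0, 3, 0]]) (by decide)
    (![![![0, 0, 0, 0], ![0, 0, 1, 0], ![0, 1, 0, 0], ![0, 0, 0, 0]], ![![0, 0, 0, 1], ![0, 0, 0, 0], ![0, 0, 0, 0], ![1, 0, 0, 0]], ![![0, 1, 0, 0], ![1, 0, 0, 1], ![0, 0, 0, 0], ![0, 1, 0, 0]], ![![0, 1, 1, 0], ![1, 0, 0, 0], ![1, 0, 0, 0], ![0, 0, 0, 0]]]) (by decide) ?_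
  clear ha; revert a; exact bipartiteTables_test

end Summit.ValiantsHypothesis.ValiantsHypothesis.Theorems.LacunarySymmetroidMatrixDescartes.Census
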